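import Mathlib.MeasureTheory.Integral.IntervalIntegral.Basic
import Mathlib.Topology.Order.Compact
import HarnessLib

/-!
# Crux K2 `PoloidalWindowRigidity` (stmt-NavierStokesRegularity-19708), line `z_shock` — R3 inhabitant census: ROTATING PATTERNS (X) —
# the DATUM SUPPLY of a zero-mean oscillation: a continuous function with zero mean, `L²`-mass `≥ E` and `|f| ≤ M` on `[a, b]`
# takes a value `≤ −E / (2M(b−a))`

`--supports stmt-NavierStokesRegularity-19708 --as helper` (leafhand-ns-poloidalwindowdoor-3 g9, cell decomp-ns, 2026-08-31).  Class-free real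
analysis, Mathlib only.  **No stub and no summit is closed by this file; Navier–Stokes regularity is NOT proved here (rung 0).**

WHY THIS FILE.  In the exterior radius-as-time problem of the rotating patterns (evidence #47/#48) blow-up along the radius needs, on a
circle of radius `r₀`, a datum of the angular-derivative variable of the BAD SIGN and of size beating the remaining source budget
(`…ZShockRiccatiForced.riccati_forced_forward_noGlobal`).  The mechanism that supplies such data is periodicity: on every circle the
angular derivative `ΘΨ` has ZERO MEAN (`…ZShockRotatingProfileFlux.integral_angularDeriv_eq_zero`), is BOUNDED
(`…ZShockRotatingProfile.angularDeriv_abs_le`), and carries the `L²`-mass controlled from below by the circle energy law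
(`…ZShockRotatingProfileEnergy.circle_energy_law`).  This file is the elementary real-analysis step turning (zero mean, mass `E`,
bound `M`) into a quantified bad-sign value — for BOTH signs:

* ★ `exists_le_neg_of_integral_eq_zero` — `f` continuous, `∫_a^b f = 0`, `E ≤ ∫_a^b f²`, `|f| ≤ M` on `[a,b]`, `0 < E`, `0 < M`, `a < b`
  ⟹ `∃ x ∈ [a,b], f(x) ≤ −E/(2M(b−a))`.  Proof: otherwise the minimum `−η'` of `f` on `[a,b]` has `η' < η := E/(2M(b−a))`, and
  `f² ≤ M|f| ≤ M(f + 2η')` integrates to `E ≤ 2Mη'(b−a) < E`.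
* `exists_ge_of_integral_eq_zero` — the sign twin (`∃ x, E/(2M(b−a)) ≤ f(x)`), from the first applied to `−f`.

[folklore] (Chebyshev/Markov-type mass argument)
-/

noncomputable section

namespace Summit.NavierStokesRegularity.NavierStokesRegularity.Theorems.PoloidalWindowDoorPoloidalWindowRigidityZShockZeroMeanDatum

-- the summit and its single sub-problem share the name (CONVENTIONS §1)
set_option linter.dupNamespace false

open Set Filter Topology MeasureTheory intervalIntegral

/-- ★ **Bad-sign datum from zero mean.**  A continuous `f` with `∫_a^b f = 0`, `E ≤ ∫_a^b f²`, `|f| ≤ M` on `[a, b]` (`0 < E`, `0 < M`,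
`a < b`) takes a value `≤ −E / (2M(b − a))` on `[a, b]`. [folklore] -/
theorem exists_le_neg_of_integral_eq_zero {f : ℝ → ℝ} {a b M E : ℝ} (hab : a < b) (hf : Continuous f)
    (hM : ∀ x ∈ Icc a b, |f x| ≤ M) (hMpos : 0 < M) (hEpos : 0 < E)
    (hmean : ∫ x in a..b, f x = 0) (hE : E ≤ ∫ x in a..b, f x ^ 2) :
    ∃ x ∈ Icc a b, f x ≤ -(E / (2 * M * (b - a))) := by
  by_contra hcon'
  have hcon : ∀ x ∈ Icc a b, -(E / (2 * M * (b - a))) < f x := fun x hx =>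
    not_le.1 fun h => hcon' ⟨x, hx, h⟩
  have hba : 0 < b - a := sub_pos.2 hab
  set η : ℝ := E / (2 * M * (b - a)) with hη
  have hηpos : 0 < η := by rw [hη]; positivity
  -- the minimum of `f` on `[a, b]`
  obtain ⟨x₀, hx₀, hmin⟩ := isCompact_Icc.exists_isMinOn (nonempty_Icc.2 hab.le) hf.continuousOn
  set η' : ℝ := max (-f x₀) 0 with hη'
  have hη'lt : η' < η := max_lt (by linarith [hcon x₀ hx₀]) hηpos
  have hη'nn : 0 ≤ η' := le_max_right _ _
  -- pointwise: `f² ≤ M |f|` and `|f| ≤ f + 2η'` on `[a, b]`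
  have h1 : ∀ x ∈ Icc a b, f x ^ 2 ≤ M * |f x| := by
    intro x hx
    nlinarith [abs_nonneg (f x), hM x hx, sq_abs (f x)]
  have h2 : ∀ x ∈ Icc a b, |f x| ≤ f x + 2 * η' := by
    intro x hx
    have hlow : f x₀ ≤ f x := hmin hx
    exact abs_le.2 ⟨by linarith [le_max_left (-f x₀) 0], by linarith⟩
  -- integrate
  have hi_sq : IntervalIntegrable (fun x => f x ^ 2) volume a b := (hf.pow 2).intervalIntegrable _ _
  have hi_abs : IntervalIntegrable (fun x => M * |f x|) volume a b :=
    (continuous_const.mul (continuous_abs.comp hf)).intervalIntegrable _ _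
  have hi_abs' : IntervalIntegrable (fun x => |f x|) volume a b := (continuous_abs.comp hf).intervalIntegrable _ _
  have hi_lin : IntervalIntegrable (fun x => f x + 2 * η') volume a b := (hf.add continuous_const).intervalIntegrable _ _
  have I1 : (∫ x in a..b, f x ^ 2) ≤ ∫ x in a..b, M * |f x| := intervalIntegral.integral_mono_on hab.le hi_sq hi_abs h1
  have I2 : (∫ x in a..b, |f x|) ≤ ∫ x in a..b, (f x + 2 * η') := intervalIntegral.integral_mono_on hab.le hi_abs' hi_lin h2
  have I3 : (∫ x in a..b, (f x + 2 * η')) = 2 * η' * (b - a) := by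
    rw [intervalIntegral.integral_add (hf.intervalIntegrable _ _) intervalIntegrable_const, hmean,
      intervalIntegral.integral_const, smul_eq_mul]
    ring
  rw [intervalIntegral.integral_const_mul] at I1
  have I4 : M * (∫ x in a..b, |f x|) ≤ M * (2 * η' * (b - a)) :=
    mul_le_mul_of_nonneg_left (I2.trans I3.le) hMpos.le
  have I5 : M * (2 * η' * (b - a)) < M * (2 * η * (b - a)) := by
    have : 2 * η' * (b - a) < 2 * η * (b - a) := by nlinarith
    exact mul_lt_mul_of_pos_left this hMpos
  have I6 : M * (2 * η * (b - a)) = E := by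
    rw [hη]; field_simp
  linarith

/-- **Good-sign twin.**  Under the same hypotheses `f` also takes a value `≥ E / (2M(b − a))` on `[a, b]`. [folklore] -/
theorem exists_ge_of_integral_eq_zero {f : ℝ → ℝ} {a b M E : ℝ} (hab : a < b) (hf : Continuous f)
    (hM : ∀ x ∈ Icc a b, |f x| ≤ M) (hMpos : 0 < M) (hEpos : 0 < E)
    (hmean : ∫ x in a..b, f x = 0) (hE : E ≤ ∫ x in a..b, f x ^ 2) :
    ∃ x ∈ Icc a b, E / (2 * M * (b - a)) ≤ f x := by
  have hM' : ∀ x ∈ Icc a b, |(-f x)| ≤ M := fun x hx => by rw [abs_neg]; exact hM x hx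
  have hmean' : ∫ x in a..b, -f x = 0 := by rw [intervalIntegral.integral_neg, hmean, neg_zero]
  have hE' : E ≤ ∫ x in a..b, (-f x) ^ 2 := by simpa only [neg_sq] using hE
  obtain ⟨x, hx, h⟩ := exists_le_neg_of_integral_eq_zero (f := fun x => -f x) hab hf.neg hM' hMpos hEpos hmean' hE'
  exact ⟨x, hx, by linarith⟩

end Summit.NavierStokesRegularity.NavierStokesRegularity.Theorems.PoloidalWindowDoorPoloidalWindowRigidityZShockZeroMeanDatum
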